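import Summits.Ventures.AbcSig.Levels.N5618P1
import Summits.Ventures.AbcSig.Levels.N5618P2
import Summits.Ventures.AbcSig.Levels.N5618P3

/-!
# Venture AbcSig — GENERATED level file, level 5618 (AGGREGATOR of 3 part files)

HONEST FRAMING. As in the part files `N5618<part>.lean`, parts P1, P2, P3 (a MIXED split: parts of
different size-splits of the same generator output landed in the tree at different times; every part carries the orbit
blocks of one contiguous run of orbits of the same certified level file `N5618.engine1.json`,
sha256 `d22d6b61a9045c26c8b35c69ace020dccf4301837a71cddd9e6317f9b84d7140`): this file only concatenates the orbit lists and the part summaries into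
`level5618Orbits`, `level5618_wellformed`, `level5618_sieve` (the shapes the row templates consume). The split exists because the
tree's files are ≤ 400 lines and ≤ 200 000 bytes. Union of residual exponents ≥ 7: [7, 13, 53]; orbits not eliminable by
the sieve: none. No Diophantine statement is made here; no claim on ABC or any summit.
-/

namespace Summit.Ventures.AbcSig

/-- All newform orbits of level 5618 (concatenation of the parts, engine order). -/
def level5618Orbits : List OrbitData :=
  level5618OrbitsP1 ++ level5618OrbitsP2 ++ level5618OrbitsP3

/-- Every listed entry is at an odd prime not dividing 5618. -/
theorem level5618_wellformed :
    ∀ o ∈ level5618Orbits, ∀ e ∈ o.coeffs, e.ell.Prime ∧ e.ell ≠ 2 ∧ ¬ e.ell ∣ 5618 := by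
  unfold level5618Orbits
  exact List.forall_mem_append.2 ⟨List.forall_mem_append.2 ⟨level5618_wellformedP1, level5618_wellformedP2⟩, level5618_wellformedP3⟩

/-- **Level 5618 summary.** For a prime exponent `n ≥ 7`, every orbit of level 5618 is sieve-eliminated by the
kernel certificates of the part files, except that the row's predicate `X` is assumed for: orbit_5618_1 if n ∈ [7], orbit_5618_2 if n ∈ [7], orbit_5618_9 if n ∈ [7], orbit_5618_10 if n ∈ [7], orbit_5618_19 if n ∈ [13], orbit_5618_20 if n ∈ [13], orbit_5618_21 if n ∈ [13], orbit_5618_22 if n ∈ [13], orbit_5618_27 if n ∈ [53], orbit_5618_28 if n ∈ [53]. -/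
theorem level5618_sieve (n : ℕ) (hn : n.Prime) (hmin : 7 ≤ n) (X : OrbitData → Prop)
    (h_orbit_5618_1 : n ∈ ([7] : List ℕ) → X orbit_5618_1)
    (h_orbit_5618_2 : n ∈ ([7] : List ℕ) → X orbit_5618_2)
    (h_orbit_5618_9 : n ∈ ([7] : List ℕ) → X orbit_5618_9)
    (h_orbit_5618_10 : n ∈ ([7] : List ℕ) → X orbit_5618_10)
    (h_orbit_5618_19 : n ∈ ([13] : List ℕ) → X orbit_5618_19)
    (h_orbit_5618_20 : n ∈ ([13] : List ℕ) → X orbit_5618_20)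
    (h_orbit_5618_21 : n ∈ ([13] : List ℕ) → X orbit_5618_21)
    (h_orbit_5618_22 : n ∈ ([13] : List ℕ) → X orbit_5618_22)
    (h_orbit_5618_27 : n ∈ ([53] : List ℕ) → X orbit_5618_27)
    (h_orbit_5618_28 : n ∈ ([53] : List ℕ) → X orbit_5618_28) :
    ∀ o ∈ level5618Orbits, (∀ e ∈ o.coeffs, e.ell.Prime ∧ e.ell ≠ 2 ∧ ¬ e.ell ∣ 5618) ∧ (o.Eliminated bs04Allowed n ∨ X o) := by
  unfold level5618Orbits
  exact List.forall_mem_append.2 ⟨List.forall_mem_append.2 ⟨(level5618_sieveP1 n hn hmin X h_orbit_5618_1 h_orbit_5618_2 h_orbit_5618_9 h_orbit_5618_10 h_orbit_5618_19 h_orbit_5618_20 h_orbit_5618_21 h_orbit_5618_22), (level5618_sieveP2 n hn hmin X)⟩, (level5618_sieveP3 n hn hmin X h_orbit_5618_27 h_orbit_5618_28)⟩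

end Summit.Ventures.AbcSig
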